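import Literature.MathematicalPhysics.QuantumFieldTheory.Balaban1983to89.Node00.N24KnitStage12All

/-!
# NODE N24 · THE CLOSER'S POINTED FORMS AT NODE 00's STAGE-12 PRESENTATION WITH EVERY CHILD AT THE PRESENTATION'S OWN OBJECTS BY NAME — N13's Cor.-3 leaves `hcor3` of modules
# 27 ∕ 28b become (UV₁₂) «(0.1) pointwise on `densOfRecord₁₀ θ.toStage9Params P k`» (module 30 `B16NodeKnitRecord12`), next to (R₁₂) `hR` and N09's [B11] Thm 1 ×3 (module 28b)

TRACK A (YM-PLAN §2d, node N24 of 28 = binder B2 `hB : B16.EndStatementBPrinted D.C`), seat `pub-ymgap-dag-n24-c` (R134 fan-out seat, strategy s2; gen 3; g2 HANDOFF trigger (t2)).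
THIRTY-SECOND N24 module, a NEW importing one (modules 1–31 untouched; imports module 31 `N24KnitStage12All`, hence module 30 `B16NodeKnitRecord12` and module 28b).  THEOREMS ONLY,
def-free, sorry-free, standard axioms.  = module 28b §3 (`N24_nodes₁₂_pointed_N09` and its three corollaries) with N13 ENTERED BY NAME: at the bound world `N13 := B16NodeKnitRecord12.
b16_main_at_record₁₂ θ w P hP hC (hup P) (hR P) le_rfl (hUV P)` — (R₁₂) `hR : ∀ P k, k < K → TLaw₁₂ θ P k → SLaw₁₂ θ P (k+1)` (unchanged: the record's 𝐑-leaf in law form) and (UV₁₂)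
`hUV` : under the interval hypothesis on `]0, w.γ]`, every repaired-§2-format level `k ≤ K` satisfies (0.1) at every configuration, with `χ = chiFixed7 θ.ν`, `A^η = wilsonBGOfRecord θ.εbg`,
`g_k = gOfRecord₁₀ θ.toStage9Params P k`, the world's own `(e₋, e₊)` ([Balaban1989LargeFieldII] (0.1) pp. 355–356, Cor. 3 pp. 387 ∕ 391 — replacing the five [Balaban1988Convergent] Cor.-3
leaves `hcor3` at `((datumOfRecord₁₂ θ hP).C, w.γ)` routed through the Stage-5 shadow).  Every other child exactly as in module 27 §1 ∕ 28b §3: N05 [B8] residual leaf at `θ.res.X P`,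
N06 def-Y's leaf at `θ.res.Y P`, N07 [B11] leaf at `θ.res.Z P`, N08 leaf-system form, N09 own Lemma-4 leaf + [Balaban1985Variational] Thm 1 ×3 at `domAltOfRecord F N θ.ν P.K k`
(`B12NodeKnitRecord12.thm3Member_stage12_of_hRestrict`), N10 B13 socket, N11 (S1ᵀ) (seat dag-n11-e's `B14NodeKnitRecord12R.b14_main_at_record₁₂_of_rOpLeaf`), N12 [IV] leaf; N01 ∕ N02 ∕
N04 def-T's transferred theorems, N03 module 23's.

WHAT THIS FILE PROVES.
§1 **`N24_nodes₁₂_pointed_all`** (`IsRecordOfRecord₁₂C F N (datumOfRecord₁₂ F N θ hP) w ∧ ∀ P, Nodes (leavesP w P)` from the pointed children), `N24_nodesAtSomeRecord₁₂_of_pointed_all`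
   (the body of `NodesAtSomeRecord12`, guard displayed), `N24_betaWindowAtSomeRecord₁₂_of_pointed_all_of_boxH` (the body of `BetaWindowAtSomeRecord12` from the β-box pair),
   `N24_endStatementBPrinted₁₂_pointed_all` ((B2) at the presentation's datum), **`N24_stabilityBR12e_thetaShape15_pointed_all`** (K1′'s rev-15 consequent, witnessed by `(θ, hP)`).

WHICH CHILD BLOCKS (closer's form, every child at the presentation's own objects): N05 [B8] residual leaf · N06 def-Y's leaf · N07 [B11] leaf · N08 leaf-system form · N09 Lemma-4 leaf +
[B11] Thm 1 ×3 · N10 B13 socket · N11 (S1ᵀ) · N12 [IV] leaf · N13 (R₁₂) law transport + (UV₁₂) (0.1) pointwise · guard + `Provisos₁₂ ∧ Admissible` = K0′ `Record12Inhabited`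
(stmt-QuantumFields-19902) · β⁺ ([I] (1.22) p. 264) + `b > 0` (NODE O, UNPRINTED).  HONEST FRAMING: kernel bookkeeping BY NAME; nothing of Bałaban's asserted; every slot DISPLAYED;
N24 COMPOSITE — no discharge, no count, no stub closed; one finite T⁴ programme at fixed ε; NOT continuum ∕ ℝ⁴ ∕ OS ∕ mass gap ∕ Clay.
-/

noncomputable section

open scoped Matrix.Norms.L2Operator

namespace Literature.MathematicalPhysics.QuantumFieldTheory.Balaban1983to89.Node00

open DagBinding T4Continuum T4DatumAssembly FlowStepRuns AveragingRT
open FlowStep (BetaLowerH BetaUpperH)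

variable {F : T4Family} {N : ℕ} [NeZero N]

/-! ## §1. The closer's pointed form, EVERY child at the presentation's own objects by name -/

/-- **N24 · THE THIRTEEN DAG NODES AT A WORLD BOUND TO THE PRESENTATION, FROM THE POINTED CHILDREN, EVERY CHILD BY NAME** (module 28b's `N24_nodes₁₂_pointed_N09` with the Cor.-3 leaves
`hcor3` ↦ (UV₁₂) pointwise at θ's objects `hUV`; N13 := module 30's `b16_main_at_record₁₂` at `(θ, w, P)`): **N05** [B8] residual leaf at `θ.res.X P` · **N06** def-Y's leaf at
`θ.res.Y P` · **N07** [B11] leaf at `θ.res.Z P` · **N08** leaf-system form of `θ.res.X P` · **N09** own Lemma-4 leaf `h09` + [Balaban1985Variational] Thm 1 ×3 at `domAltOfRecord F N θ.ν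
P.K k` (`h11dom`, `hres`, `huniq`; the record's `contT` inside) · **N10** B13 socket · **N11** (S1ᵀ) `h11` · **N12** [IV] leaf at `θ.res.W P` · **N13** (R₁₂) `hR` + (UV₁₂) `hUV` (0.1 pointwise
on `densOfRecord₁₀ θ.toStage9Params P k`, the world's own `(e₋, e₊)`, interval on `]0, w.γ]`); N01 ∕ N02 ∕ N04 def-T's transferred theorems, N03 module 23's.  THE HYPOTHESIS LIST IS
«WHICH CHILD BLOCKS `stub_nodes12`» IN THE CLOSER'S FORM, EVERY CHILD AT THE PRESENTATION'S OWN OBJECTS. [cite: Balaban1989LargeFieldII, Thm 1 p.355, (0.1) pp.355–356, p.387, p.391; Balaban1988Convergent, Thm 1 p.262, Theorem p.245, p.244, (2.18) p.257, Cor. 3 (2.50) p.264; Balaban1987RG1, Thm 1 p.259, Thm 3 p.264, Lemma 4 (3.53) p.280, (1.1)–(1.3) p.260; Balaban1985Variational, Thm 1 (8)–(10) p.279; Balaban1985RegularSpaces, Thms 2, 4, 8 pp.83–101; Balaban1985BackgroundPropagators, Thms 3.1–3.15 pp.397–432; Balaban1985UV3, Thm 1 p.257 + Thm 2 p.272; Balaban1988RG2Cluster,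 Lemmas 1–3 pp.9, 11, 20; Balaban1989LargeFieldI, Prop. 1 p.194 (node bookkeeping at the presentation's own objects)] -/
theorem N24_nodes₁₂_pointed_all (θ : Stage12Params F N) (hP : θ.Provisos₁₂ F N) (hθ : θ.Admissible F N) (w : WorldP)
    (hC : w.C = (datumOfRecord₁₂ F N θ hP).C) (hγ : 0 < w.γ ∧ w.γ ≤ θ.γ) (hL : w.L = (θ.L : ℝ))
    (hup : ∀ P, w.up P = upOfRecord₅C F N (θ.toStage5₁₂ F N) P)
    (h05 : ∀ P : B12.RunParams,
      B8LeafR (θ.res.X P).d8 (θ.res.X P).L8 (θ.res.X P).C₂ (θ.res.X P).B₁' (θ.res.X P).B₀' (θ.res.X P).B₁ (θ.res.X P).B₂ (θ.res.X P).c₁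
        (θ.res.X P).inp8 (θ.res.X P).B₀β (θ.res.X P).loc8 (θ.res.X P).fam8R (θ.res.X P).lan8 (θ.res.X P).cub8 (θ.res.X P).toAxial8)
    (h06 : ∀ P : B12.RunParams, B9LeafX (θ.res.Y P))
    (h07 : ∀ P : B12.RunParams, B11Leaf (θ.res.Z P))
    (h08 : ∀ P : B12.RunParams, ∃ (Xc : PrintedCarriersR) (I : Type) (C : B10Assembly.Consts) (T : I → B10.TowerRun),
      Nonempty (∀ i, B10Assembly.LeafSystem C (T i)) ∧ θ.res.X P = Xc.withTowerRuns10 T)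
    (h09 : ∀ P : B12.RunParams, B12Sec2to5.Lemma4Printed (θ.res.X P).F12 (θ.res.X P).c12)
    (h11dom : ∀ (P : B12.RunParams) (k : ℕ), k ≤ P.K →
      ∀ V ∈ domAltOfRecord F N θ.ν P.K k, UkExists F N P.K k θ.εbg V ∧ UniqueUkOrbit F N P.K k θ.εbg V)
    (hres : ∀ (P : B12.RunParams) (k : ℕ), k ≤ P.K → HRestrict F N θ.εbg P.K k (domAltOfRecord F N θ.ν P.K k))
    (huniq : ∀ (P : B12.RunParams) (k : ℕ), k ≤ P.K → ∀ V ∈ domAltOfRecord F N θ.ν P.K k, ∀ j < k,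
      UniqueUkOrbit F N P.K (j + 1) θ.εbg (Averaging.iter (avOfRecord F N P.K) (j + 1) (Uk F N P.K k θ.εbg V)))
    (h10 : ∀ P : B12.RunParams, B9LeafX (θ.res.Y P) →
      (B10.Thm1PrintedCompact (θ.res.X P).runs10 ∧ B10.Thm2Printed (θ.res.X P).runs10) →
        B11Leaf (θ.res.Z P) → B12Sec2to5.Lemma4Printed (θ.res.X P).F12 (θ.res.X P).c12 →
          B13.Lemma1Printed (θ.res.X P).S13 (θ.res.X P).c13 ∧ B13.Lemma2Printed (θ.res.X P).S13 (θ.res.X P).c13 ∧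
            B13.Lemma3Printed (θ.res.X P).S13 (θ.res.X P).c13)
    (h11 : ∀ P : B12.RunParams, (leavesP w P).b7 → (leavesP w P).b8 → (leavesP w P).b9 → (leavesP w P).b10 → (leavesP w P).b11 →
      (leavesP w P).smallCouplings → (leavesP w P).smallFieldInductive → (leavesP w P).flowControl →
        ∀ k, k < P.K → SLaw₁₂ F N θ P k → TLaw₁₂ F N θ P k)
    (h12 : ∀ P : B12.RunParams, B15Leaf (θ.res.W P))
    (hR : ∀ (P : B12.RunParams) (k : ℕ), k < P.K → TLaw₁₂ F N θ P k → SLaw₁₂ F N θ P (k + 1))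
    (hUV : ∀ P : B12.RunParams, (genFlow (betaOfRecord₁₀ F N θ.toStage9Params) P.g0).InInterval w.γ P.K → ∀ k, k ≤ P.K → SLaw₁₂ F N θ P k →
      ∀ U : GaugeField (F.P P.K) k (SU N),
        chiFixed7 F N θ.ν P.K (gOfRecord₁₀ F N θ.toStage9Params P) k U *
              Real.exp (-(1 / (gOfRecord₁₀ F N θ.toStage9Params P k) ^ 2 * wilsonBGOfRecord F N θ.εbg P k U)
                - w.em (gOfRecord₁₀ F N θ.toStage9Params P k) * (Fintype.card (Site (F.P P.K) k) : ℝ)) ≤ densOfRecord₁₀ F N θ.toStage9Params P k U ∧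
        densOfRecord₁₀ F N θ.toStage9Params P k U ≤ Real.exp (w.ep (gOfRecord₁₀ F N θ.toStage9Params P k) * (Fintype.card (Site (F.P P.K) k) : ℝ))) :
    IsRecordOfRecord₁₂C F N (datumOfRecord₁₂ F N θ hP) w ∧ ∀ P : B12.RunParams, Nodes (leavesP w P) := by
  have hrec : IsRecordOfRecord₁₂C F N (datumOfRecord₁₂ F N θ hP) w := ⟨θ, hP, hθ, rfl, hC, hγ, hL, hup⟩
  refine ⟨hrec, fun P => ?_⟩
  have hl := B11LeafUnpinnedRecord.upOfRecord₅C_b8_b9_b11 (θ.toStage5₁₂ F N) P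
  have h8 : (w.up P).b8 := by rw [hup P]; exact hl.1.2 (h05 P)
  have h9 : (w.up P).b9 := by rw [hup P]; exact hl.2.1.2 (h06 P)
  have h15 : (w.up P).rBasicStep := by
    rw [hup P]; exact (B15LeafKnitRecord7.rBasicStep_upOfRecord₅C_iff (θ.toStage5₁₂ F N) P).2 (h12 P)
  have h12leaf : (leavesP w P).b12 := by
    show (w.up P).b12
    rw [hup P]; exact h09 P
  obtain ⟨Xc, I, C, T, ⟨S⟩, hX⟩ := h08 P
  exact ⟨b4_main_of_isRecordOfRecord₁₂C hrec P, b5_main_of_isRecordOfRecord₁₂C hrec P, N24_b6_main_of_isRecordOfRecord₁₂C hrec P,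
    b7_main_of_isRecordOfRecord₁₂C hrec P, B8LeafKnit.b8_main_of_leaf w P h8, fun _ _ _ _ => h9,
    B10LeafUnpinnedRecord5C.b10_main_of_upOfRecord₅C_of_leafSystems (θ.toStage5₁₂ F N) (hup P) Xc S hX,
    B11LeafUnpinnedRecord.b11_main_of_upOfRecord₅C_of_b11Leaf (θ.toStage5₁₂ F N) P (hup P) (h07 P),
    B12NodeKnitRecord8.b12_main_of_leaf_of_thm3Member h12leaf
      (B12NodeKnitRecord12.thm3Member_stage12_of_hRestrict θ hP hC P (h11dom P) (hres P) (huniq P)),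
    B13NodeKnitRecord5C.b13_main_at_stage5ParamsC F N (θ.toStage5₁₂ F N) w P (hup P) (h10 P),
    B14NodeKnitRecord12R.b14_main_at_record₁₂_of_rOpLeaf F N θ hP w P hC
      (B14NodeKnitRecord12R.rOperation_iff_rOpLeaf₁₂ F N θ w P (hup P)).1 (h11 P),
    B15LeafKnit.b15_main_of_up (U := w.up P) rfl h15,
    B16NodeKnitRecord12.b16_main_at_record₁₂ F N θ w P hP hC (hup P) (hR P) le_rfl (hUV P)⟩

/-- **THE BODY OF `NodesAtSomeRecord12` FROM THE POINTED CHILDREN, EVERY CHILD BY NAME** (module 27's `N24_nodesAtSomeRecord₁₂_of_pointed` with `h09T` ↦ [B11] Thm 1 ×3 and `hcor3` ↦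
(UV₁₂); general `N`, guard `hU` DISPLAYED — K0′'s product) — witnesses `(θ, hP, w)` themselves.  COMPOSITE: nothing is discharged.
[cite: Balaban1989LargeFieldII, Thm 1 p.355, (0.1) pp.355–356, p.391; Balaban1988Convergent, Thm 1 p.262, Cor. 3 (2.50) p.264; Balaban1987RG1, Thm 3 p.264; Balaban1985Variational, Thm 1 p.279 (bookkeeping)] -/
theorem N24_nodesAtSomeRecord₁₂_of_pointed_all (θ : Stage12Params F N) (hP : θ.Provisos₁₂ F N) (hθ : θ.Admissible F N)
    (hU : θ.ZtUnity F N ∧ θ.SlotsNondegenerate) (w : WorldP)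
    (hC : w.C = (datumOfRecord₁₂ F N θ hP).C) (hγ : 0 < w.γ ∧ w.γ ≤ θ.γ) (hL : w.L = (θ.L : ℝ))
    (hup : ∀ P, w.up P = upOfRecord₅C F N (θ.toStage5₁₂ F N) P)
    (h05 : ∀ P : B12.RunParams,
      B8LeafR (θ.res.X P).d8 (θ.res.X P).L8 (θ.res.X P).C₂ (θ.res.X P).B₁' (θ.res.X P).B₀' (θ.res.X P).B₁ (θ.res.X P).B₂ (θ.res.X P).c₁
        (θ.res.X P).inp8 (θ.res.X P).B₀β (θ.res.X P).loc8 (θ.res.X P).fam8R (θ.res.X P).lan8 (θ.res.X P).cub8 (θ.res.X P).toAxial8)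
    (h06 : ∀ P : B12.RunParams, B9LeafX (θ.res.Y P))
    (h07 : ∀ P : B12.RunParams, B11Leaf (θ.res.Z P))
    (h08 : ∀ P : B12.RunParams, ∃ (Xc : PrintedCarriersR) (I : Type) (C : B10Assembly.Consts) (T : I → B10.TowerRun),
      Nonempty (∀ i, B10Assembly.LeafSystem C (T i)) ∧ θ.res.X P = Xc.withTowerRuns10 T)
    (h09 : ∀ P : B12.RunParams, B12Sec2to5.Lemma4Printed (θ.res.X P).F12 (θ.res.X P).c12)
    (h11dom : ∀ (P : B12.RunParams) (k : ℕ), k ≤ P.K →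
      ∀ V ∈ domAltOfRecord F N θ.ν P.K k, UkExists F N P.K k θ.εbg V ∧ UniqueUkOrbit F N P.K k θ.εbg V)
    (hres : ∀ (P : B12.RunParams) (k : ℕ), k ≤ P.K → HRestrict F N θ.εbg P.K k (domAltOfRecord F N θ.ν P.K k))
    (huniq : ∀ (P : B12.RunParams) (k : ℕ), k ≤ P.K → ∀ V ∈ domAltOfRecord F N θ.ν P.K k, ∀ j < k,
      UniqueUkOrbit F N P.K (j + 1) θ.εbg (Averaging.iter (avOfRecord F N P.K) (j + 1) (Uk F N P.K k θ.εbg V)))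
    (h10 : ∀ P : B12.RunParams, B9LeafX (θ.res.Y P) →
      (B10.Thm1PrintedCompact (θ.res.X P).runs10 ∧ B10.Thm2Printed (θ.res.X P).runs10) →
        B11Leaf (θ.res.Z P) → B12Sec2to5.Lemma4Printed (θ.res.X P).F12 (θ.res.X P).c12 →
          B13.Lemma1Printed (θ.res.X P).S13 (θ.res.X P).c13 ∧ B13.Lemma2Printed (θ.res.X P).S13 (θ.res.X P).c13 ∧
            B13.Lemma3Printed (θ.res.X P).S13 (θ.res.X P).c13)
    (h11 : ∀ P : B12.RunParams, (leavesP w P).b7 → (leavesP w P).b8 → (leavesP w P).b9 → (leavesP w P).b10 → (leavesP w P).b11 →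
      (leavesP w P).smallCouplings → (leavesP w P).smallFieldInductive → (leavesP w P).flowControl →
        ∀ k, k < P.K → SLaw₁₂ F N θ P k → TLaw₁₂ F N θ P k)
    (h12 : ∀ P : B12.RunParams, B15Leaf (θ.res.W P))
    (hR : ∀ (P : B12.RunParams) (k : ℕ), k < P.K → TLaw₁₂ F N θ P k → SLaw₁₂ F N θ P (k + 1))
    (hUV : ∀ P : B12.RunParams, (genFlow (betaOfRecord₁₀ F N θ.toStage9Params) P.g0).InInterval w.γ P.K → ∀ k, k ≤ P.K → SLaw₁₂ F N θ P k →
      ∀ U : GaugeField (F.P P.K) k (SU N),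
        chiFixed7 F N θ.ν P.K (gOfRecord₁₀ F N θ.toStage9Params P) k U *
              Real.exp (-(1 / (gOfRecord₁₀ F N θ.toStage9Params P k) ^ 2 * wilsonBGOfRecord F N θ.εbg P k U)
                - w.em (gOfRecord₁₀ F N θ.toStage9Params P k) * (Fintype.card (Site (F.P P.K) k) : ℝ)) ≤ densOfRecord₁₀ F N θ.toStage9Params P k U ∧
        densOfRecord₁₀ F N θ.toStage9Params P k U ≤ Real.exp (w.ep (gOfRecord₁₀ F N θ.toStage9Params P k) * (Fintype.card (Site (F.P P.K) k) : ℝ))) :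
    ∃ (θ' : Stage12Params F N) (h' : θ'.Provisos₁₂ F N) (w' : WorldP), (θ'.ZtUnity F N ∧ θ'.SlotsNondegenerate) ∧ θ'.Admissible F N ∧
      IsRecordOfRecord₁₂C F N (datumOfRecord₁₂ F N θ' h') w' ∧ ∀ P : B12.RunParams, Nodes (leavesP w' P) := by
  obtain ⟨hrec, hn⟩ := N24_nodes₁₂_pointed_all θ hP hθ w hC hγ hL hup h05 h06 h07 h08 h09 h11dom hres huniq h10 h11 h12 hR hUV
  exact ⟨θ, hP, w, hU, hθ, hrec, hn⟩

/-- **THE BODY OF `BetaWindowAtSomeRecord12` FROM THE POINTED CHILDREN, EVERY CHILD BY NAME, AND THE β-BOX PAIR** (module 28b's `N24_betaWindowAtSomeRecord₁₂_of_pointed_N09_of_boxH`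
with `hcor3` ↦ (UV₁₂)): additionally `w.b ≤ (datumOfRecord₁₂ θ hP).βfun ≤ w.βup` on `]0, w.γ]^{k+1}` (upper: [Balaban1987RG1] (1.22) p. 264, proof deferred in print; lower with `w.b > 0`:
UNPRINTED, T09.F = NODE O) ⇒ `BetaBoundsInInterval` and the crux's window (module 26 §2) — witnesses `(θ, hP, w)` themselves.
[cite: Balaban1987RG1, §1 (1.22) p.264, Thm 2 p.259, Thm 3 p.264, (0.17)–(0.20) pp.255–256; Balaban1985Variational, Thm 1 p.279; Balaban1989LargeFieldII, Thm 1 p.355, (0.1) pp.355–356 (bookkeeping)] -/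
theorem N24_betaWindowAtSomeRecord₁₂_of_pointed_all_of_boxH (θ : Stage12Params F N) (hP : θ.Provisos₁₂ F N) (hθ : θ.Admissible F N)
    (hU : θ.ZtUnity F N ∧ θ.SlotsNondegenerate) (w : WorldP)
    (hC : w.C = (datumOfRecord₁₂ F N θ hP).C) (hγ : 0 < w.γ ∧ w.γ ≤ θ.γ) (hL : w.L = (θ.L : ℝ))
    (hup : ∀ P, w.up P = upOfRecord₅C F N (θ.toStage5₁₂ F N) P)
    (h05 : ∀ P : B12.RunParams,
      B8LeafR (θ.res.X P).d8 (θ.res.X P).L8 (θ.res.X P).C₂ (θ.res.X P).B₁' (θ.res.X P).B₀' (θ.res.X P).B₁ (θ.res.X P).B₂ (θ.res.X P).c₁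
        (θ.res.X P).inp8 (θ.res.X P).B₀β (θ.res.X P).loc8 (θ.res.X P).fam8R (θ.res.X P).lan8 (θ.res.X P).cub8 (θ.res.X P).toAxial8)
    (h06 : ∀ P : B12.RunParams, B9LeafX (θ.res.Y P))
    (h07 : ∀ P : B12.RunParams, B11Leaf (θ.res.Z P))
    (h08 : ∀ P : B12.RunParams, ∃ (Xc : PrintedCarriersR) (I : Type) (C : B10Assembly.Consts) (T : I → B10.TowerRun),
      Nonempty (∀ i, B10Assembly.LeafSystem C (T i)) ∧ θ.res.X P = Xc.withTowerRuns10 T)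
    (h09 : ∀ P : B12.RunParams, B12Sec2to5.Lemma4Printed (θ.res.X P).F12 (θ.res.X P).c12)
    (h11dom : ∀ (P : B12.RunParams) (k : ℕ), k ≤ P.K →
      ∀ V ∈ domAltOfRecord F N θ.ν P.K k, UkExists F N P.K k θ.εbg V ∧ UniqueUkOrbit F N P.K k θ.εbg V)
    (hres : ∀ (P : B12.RunParams) (k : ℕ), k ≤ P.K → HRestrict F N θ.εbg P.K k (domAltOfRecord F N θ.ν P.K k))
    (huniq : ∀ (P : B12.RunParams) (k : ℕ), k ≤ P.K → ∀ V ∈ domAltOfRecord F N θ.ν P.K k, ∀ j < k,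
      UniqueUkOrbit F N P.K (j + 1) θ.εbg (Averaging.iter (avOfRecord F N P.K) (j + 1) (Uk F N P.K k θ.εbg V)))
    (h10 : ∀ P : B12.RunParams, B9LeafX (θ.res.Y P) →
      (B10.Thm1PrintedCompact (θ.res.X P).runs10 ∧ B10.Thm2Printed (θ.res.X P).runs10) →
        B11Leaf (θ.res.Z P) → B12Sec2to5.Lemma4Printed (θ.res.X P).F12 (θ.res.X P).c12 →
          B13.Lemma1Printed (θ.res.X P).S13 (θ.res.X P).c13 ∧ B13.Lemma2Printed (θ.res.X P).S13 (θ.res.X P).c13 ∧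
            B13.Lemma3Printed (θ.res.X P).S13 (θ.res.X P).c13)
    (h11 : ∀ P : B12.RunParams, (leavesP w P).b7 → (leavesP w P).b8 → (leavesP w P).b9 → (leavesP w P).b10 → (leavesP w P).b11 →
      (leavesP w P).smallCouplings → (leavesP w P).smallFieldInductive → (leavesP w P).flowControl →
        ∀ k, k < P.K → SLaw₁₂ F N θ P k → TLaw₁₂ F N θ P k)
    (h12 : ∀ P : B12.RunParams, B15Leaf (θ.res.W P))
    (hR : ∀ (P : B12.RunParams) (k : ℕ), k < P.K → TLaw₁₂ F N θ P k → SLaw₁₂ F N θ P (k + 1))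
    (hUV : ∀ P : B12.RunParams, (genFlow (betaOfRecord₁₀ F N θ.toStage9Params) P.g0).InInterval w.γ P.K → ∀ k, k ≤ P.K → SLaw₁₂ F N θ P k →
      ∀ U : GaugeField (F.P P.K) k (SU N),
        chiFixed7 F N θ.ν P.K (gOfRecord₁₀ F N θ.toStage9Params P) k U *
              Real.exp (-(1 / (gOfRecord₁₀ F N θ.toStage9Params P k) ^ 2 * wilsonBGOfRecord F N θ.εbg P k U)
                - w.em (gOfRecord₁₀ F N θ.toStage9Params P k) * (Fintype.card (Site (F.P P.K) k) : ℝ)) ≤ densOfRecord₁₀ F N θ.toStage9Params P k U ∧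
        densOfRecord₁₀ F N θ.toStage9Params P k U ≤ Real.exp (w.ep (gOfRecord₁₀ F N θ.toStage9Params P k) * (Fintype.card (Site (F.P P.K) k) : ℝ)))
    (hlo : BetaLowerH w.b w.γ (datumOfRecord₁₂ F N θ hP).βfun) (hhi : BetaUpperH w.βup w.γ (datumOfRecord₁₂ F N θ hP).βfun) :
    ∃ (θ' : Stage12Params F N) (h' : θ'.Provisos₁₂ F N) (w' : WorldP), (θ'.ZtUnity F N ∧ θ'.SlotsNondegenerate) ∧ θ'.Admissible F N ∧
      IsRecordOfRecord₁₂C F N (datumOfRecord₁₂ F N θ' h') w' ∧ (∀ P : B12.RunParams, Nodes (leavesP w' P)) ∧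
      BetaBoundsInInterval w'.C.toB12 w'.γ w'.b w'.βup ∧
      ∃ γ₁ : ℝ, 0 < γ₁ ∧ ∀ γ : ℝ, 0 < γ → γ ≤ γ₁ → ∃ P : B12.RunParams, 1 ≤ P.K ∧ ((datumOfRecord₁₂ F N θ' h').C P).flow.InInterval γ P.K := by
  obtain ⟨hrec, hn⟩ := N24_nodes₁₂_pointed_all θ hP hθ w hC hγ hL hup h05 h06 h07 h08 h09 h11dom hres huniq h10 h11 h12 hR hUV
  exact ⟨θ, hP, w, hU, hθ, hrec, hn, N24_betaBoundsInInterval_of_isRecordOfRecord₁₂C_of_boxH hrec hlo hhi,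
    N24_window_of_betaUpperH _ hγ.1 hhi⟩

/-- **N24 · (B2) AT THE PRESENTATION'S DATUM FROM THE POINTED CHILDREN, EVERY CHILD BY NAME, AND THE β-BOX PAIR**: `B16.EndStatementBPrinted (datumOfRecord₁₂ F N θ hP).C` — §1's nodes at
the bound world, the interval β-binder from the box pair (module 26 §2), def-T's END headline `endStatementBPrinted_of_isRecordOfRecord₁₂C_of_nodes` (`γ₀ := w.γ`).  COMPOSITE.
[cite: Balaban1989LargeFieldII, Thm 1 p.355, (0.1) pp.355–356, p.391; Balaban1987RG1, (1.22) p.264 (bookkeeping at the presentation's own objects)] -/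
theorem N24_endStatementBPrinted₁₂_pointed_all (θ : Stage12Params F N) (hP : θ.Provisos₁₂ F N) (hθ : θ.Admissible F N) (w : WorldP)
    (hC : w.C = (datumOfRecord₁₂ F N θ hP).C) (hγ : 0 < w.γ ∧ w.γ ≤ θ.γ) (hL : w.L = (θ.L : ℝ))
    (hup : ∀ P, w.up P = upOfRecord₅C F N (θ.toStage5₁₂ F N) P)
    (h05 : ∀ P : B12.RunParams,
      B8LeafR (θ.res.X P).d8 (θ.res.X P).L8 (θ.res.X P).C₂ (θ.res.X P).B₁' (θ.res.X P).B₀' (θ.res.X P).B₁ (θ.res.X P).B₂ (θ.res.X P).c₁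
        (θ.res.X P).inp8 (θ.res.X P).B₀β (θ.res.X P).loc8 (θ.res.X P).fam8R (θ.res.X P).lan8 (θ.res.X P).cub8 (θ.res.X P).toAxial8)
    (h06 : ∀ P : B12.RunParams, B9LeafX (θ.res.Y P))
    (h07 : ∀ P : B12.RunParams, B11Leaf (θ.res.Z P))
    (h08 : ∀ P : B12.RunParams, ∃ (Xc : PrintedCarriersR) (I : Type) (C : B10Assembly.Consts) (T : I → B10.TowerRun),
      Nonempty (∀ i, B10Assembly.LeafSystem C (T i)) ∧ θ.res.X P = Xc.withTowerRuns10 T)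
    (h09 : ∀ P : B12.RunParams, B12Sec2to5.Lemma4Printed (θ.res.X P).F12 (θ.res.X P).c12)
    (h11dom : ∀ (P : B12.RunParams) (k : ℕ), k ≤ P.K →
      ∀ V ∈ domAltOfRecord F N θ.ν P.K k, UkExists F N P.K k θ.εbg V ∧ UniqueUkOrbit F N P.K k θ.εbg V)
    (hres : ∀ (P : B12.RunParams) (k : ℕ), k ≤ P.K → HRestrict F N θ.εbg P.K k (domAltOfRecord F N θ.ν P.K k))
    (huniq : ∀ (P : B12.RunParams) (k : ℕ), k ≤ P.K → ∀ V ∈ domAltOfRecord F N θ.ν P.K k, ∀ j < k,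
      UniqueUkOrbit F N P.K (j + 1) θ.εbg (Averaging.iter (avOfRecord F N P.K) (j + 1) (Uk F N P.K k θ.εbg V)))
    (h10 : ∀ P : B12.RunParams, B9LeafX (θ.res.Y P) →
      (B10.Thm1PrintedCompact (θ.res.X P).runs10 ∧ B10.Thm2Printed (θ.res.X P).runs10) →
        B11Leaf (θ.res.Z P) → B12Sec2to5.Lemma4Printed (θ.res.X P).F12 (θ.res.X P).c12 →
          B13.Lemma1Printed (θ.res.X P).S13 (θ.res.X P).c13 ∧ B13.Lemma2Printed (θ.res.X P).S13 (θ.res.X P).c13 ∧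
            B13.Lemma3Printed (θ.res.X P).S13 (θ.res.X P).c13)
    (h11 : ∀ P : B12.RunParams, (leavesP w P).b7 → (leavesP w P).b8 → (leavesP w P).b9 → (leavesP w P).b10 → (leavesP w P).b11 →
      (leavesP w P).smallCouplings → (leavesP w P).smallFieldInductive → (leavesP w P).flowControl →
        ∀ k, k < P.K → SLaw₁₂ F N θ P k → TLaw₁₂ F N θ P k)
    (h12 : ∀ P : B12.RunParams, B15Leaf (θ.res.W P))
    (hR : ∀ (P : B12.RunParams) (k : ℕ), k < P.K → TLaw₁₂ F N θ P k → SLaw₁₂ F N θ P (k + 1))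
    (hUV : ∀ P : B12.RunParams, (genFlow (betaOfRecord₁₀ F N θ.toStage9Params) P.g0).InInterval w.γ P.K → ∀ k, k ≤ P.K → SLaw₁₂ F N θ P k →
      ∀ U : GaugeField (F.P P.K) k (SU N),
        chiFixed7 F N θ.ν P.K (gOfRecord₁₀ F N θ.toStage9Params P) k U *
              Real.exp (-(1 / (gOfRecord₁₀ F N θ.toStage9Params P k) ^ 2 * wilsonBGOfRecord F N θ.εbg P k U)
                - w.em (gOfRecord₁₀ F N θ.toStage9Params P k) * (Fintype.card (Site (F.P P.K) k) : ℝ)) ≤ densOfRecord₁₀ F N θ.toStage9Params P k U ∧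
        densOfRecord₁₀ F N θ.toStage9Params P k U ≤ Real.exp (w.ep (gOfRecord₁₀ F N θ.toStage9Params P k) * (Fintype.card (Site (F.P P.K) k) : ℝ)))
    (hlo : BetaLowerH w.b w.γ (datumOfRecord₁₂ F N θ hP).βfun) (hhi : BetaUpperH w.βup w.γ (datumOfRecord₁₂ F N θ hP).βfun) :
    B16.EndStatementBPrinted (datumOfRecord₁₂ F N θ hP).C := by
  obtain ⟨hrec, hn⟩ := N24_nodes₁₂_pointed_all θ hP hθ w hC hγ hL hup h05 h06 h07 h08 h09 h11dom hres huniq h10 h11 h12 hR hUV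
  exact endStatementBPrinted_of_isRecordOfRecord₁₂C_of_nodes hrec le_rfl hn (N24_betaBoundsInInterval_of_isRecordOfRecord₁₂C_of_boxH hrec hlo hhi)

/-- **THE CONSEQUENT OF ITEM K1′ `StabilityBAtRecordR12e` (rev 15, stmt-QuantumFields-19903) FROM THE POINTED CHILDREN, EVERY CHILD BY NAME, AND THE β-BOX PAIR**, witnessed by `(θ, hP)`
(module 28b's `N24_stabilityBR12e_thetaShape15_pointed_N09` with `hcor3` ↦ (UV₁₂)).  THE CLOSER'S RECIPE: a guarded admissible presentation (K0′ `Record12Inhabited`), the children at its own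
objects — N05 [B8] residual leaf · N06 def-Y's leaf · N07 [B11] leaf · N08 leaf-system form · N09 Lemma-4 leaf + [B11] Thm 1 ×3 at the level domains · N10 B13 socket · N11 (S1ᵀ) · N12 [IV]
leaf · N13 (R₁₂) law transport + (UV₁₂) (0.1) pointwise at `densOfRecord₁₀ θ.toStage9Params` — and the β-box pair (β⁺ [I] p. 264; `b > 0` NODE O, UNPRINTED).  COMPOSITE: nothing is
discharged. [cite: Balaban1989LargeFieldII, Thm 1 p.355, (0.1) pp.355–356, p.391; Balaban1988Convergent, (3.16)–(3.22) pp.268–269; Balaban1987RG1, Thm 3 p.264, (0.17)–(0.20) pp.255–256 and (1.22) p.264; Balaban1985Variational, Thm 1 p.279 (bookkeeping + elementary window)] -/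
theorem N24_stabilityBR12e_thetaShape15_pointed_all (θ : Stage12Params F N) (hP : θ.Provisos₁₂ F N) (hθ : θ.Admissible F N)
    (hU : θ.ZtUnity F N ∧ θ.SlotsNondegenerate) (w : WorldP)
    (hC : w.C = (datumOfRecord₁₂ F N θ hP).C) (hγ : 0 < w.γ ∧ w.γ ≤ θ.γ) (hL : w.L = (θ.L : ℝ))
    (hup : ∀ P, w.up P = upOfRecord₅C F N (θ.toStage5₁₂ F N) P)
    (h05 : ∀ P : B12.RunParams,
      B8LeafR (θ.res.X P).d8 (θ.res.X P).L8 (θ.res.X P).C₂ (θ.res.X P).B₁' (θ.res.X P).B₀' (θ.res.X P).B₁ (θ.res.X P).B₂ (θ.res.X P).c₁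
        (θ.res.X P).inp8 (θ.res.X P).B₀β (θ.res.X P).loc8 (θ.res.X P).fam8R (θ.res.X P).lan8 (θ.res.X P).cub8 (θ.res.X P).toAxial8)
    (h06 : ∀ P : B12.RunParams, B9LeafX (θ.res.Y P))
    (h07 : ∀ P : B12.RunParams, B11Leaf (θ.res.Z P))
    (h08 : ∀ P : B12.RunParams, ∃ (Xc : PrintedCarriersR) (I : Type) (C : B10Assembly.Consts) (T : I → B10.TowerRun),
      Nonempty (∀ i, B10Assembly.LeafSystem C (T i)) ∧ θ.res.X P = Xc.withTowerRuns10 T)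
    (h09 : ∀ P : B12.RunParams, B12Sec2to5.Lemma4Printed (θ.res.X P).F12 (θ.res.X P).c12)
    (h11dom : ∀ (P : B12.RunParams) (k : ℕ), k ≤ P.K →
      ∀ V ∈ domAltOfRecord F N θ.ν P.K k, UkExists F N P.K k θ.εbg V ∧ UniqueUkOrbit F N P.K k θ.εbg V)
    (hres : ∀ (P : B12.RunParams) (k : ℕ), k ≤ P.K → HRestrict F N θ.εbg P.K k (domAltOfRecord F N θ.ν P.K k))
    (huniq : ∀ (P : B12.RunParams) (k : ℕ), k ≤ P.K → ∀ V ∈ domAltOfRecord F N θ.ν P.K k, ∀ j < k,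
      UniqueUkOrbit F N P.K (j + 1) θ.εbg (Averaging.iter (avOfRecord F N P.K) (j + 1) (Uk F N P.K k θ.εbg V)))
    (h10 : ∀ P : B12.RunParams, B9LeafX (θ.res.Y P) →
      (B10.Thm1PrintedCompact (θ.res.X P).runs10 ∧ B10.Thm2Printed (θ.res.X P).runs10) →
        B11Leaf (θ.res.Z P) → B12Sec2to5.Lemma4Printed (θ.res.X P).F12 (θ.res.X P).c12 →
          B13.Lemma1Printed (θ.res.X P).S13 (θ.res.X P).c13 ∧ B13.Lemma2Printed (θ.res.X P).S13 (θ.res.X P).c13 ∧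
            B13.Lemma3Printed (θ.res.X P).S13 (θ.res.X P).c13)
    (h11 : ∀ P : B12.RunParams, (leavesP w P).b7 → (leavesP w P).b8 → (leavesP w P).b9 → (leavesP w P).b10 → (leavesP w P).b11 →
      (leavesP w P).smallCouplings → (leavesP w P).smallFieldInductive → (leavesP w P).flowControl →
        ∀ k, k < P.K → SLaw₁₂ F N θ P k → TLaw₁₂ F N θ P k)
    (h12 : ∀ P : B12.RunParams, B15Leaf (θ.res.W P))
    (hR : ∀ (P : B12.RunParams) (k : ℕ), k < P.K → TLaw₁₂ F N θ P k → SLaw₁₂ F N θ P (k + 1))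
    (hUV : ∀ P : B12.RunParams, (genFlow (betaOfRecord₁₀ F N θ.toStage9Params) P.g0).InInterval w.γ P.K → ∀ k, k ≤ P.K → SLaw₁₂ F N θ P k →
      ∀ U : GaugeField (F.P P.K) k (SU N),
        chiFixed7 F N θ.ν P.K (gOfRecord₁₀ F N θ.toStage9Params P) k U *
              Real.exp (-(1 / (gOfRecord₁₀ F N θ.toStage9Params P k) ^ 2 * wilsonBGOfRecord F N θ.εbg P k U)
                - w.em (gOfRecord₁₀ F N θ.toStage9Params P k) * (Fintype.card (Site (F.P P.K) k) : ℝ)) ≤ densOfRecord₁₀ F N θ.toStage9Params P k U ∧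
        densOfRecord₁₀ F N θ.toStage9Params P k U ≤ Real.exp (w.ep (gOfRecord₁₀ F N θ.toStage9Params P k) * (Fintype.card (Site (F.P P.K) k) : ℝ)))
    (hlo : BetaLowerH w.b w.γ (datumOfRecord₁₂ F N θ hP).βfun) (hhi : BetaUpperH w.βup w.γ (datumOfRecord₁₂ F N θ hP).βfun) :
    ∃ (θ' : Stage12Params F N) (h' : θ'.Provisos₁₂ F N), (θ'.ZtUnity F N ∧ θ'.SlotsNondegenerate) ∧ θ'.Admissible F N ∧
      B16.EndStatementBPrinted (datumOfRecord₁₂ F N θ' h').C ∧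
      ∃ γ₁ : ℝ, 0 < γ₁ ∧ ∀ γ : ℝ, 0 < γ → γ ≤ γ₁ → ∃ P : B12.RunParams, 1 ≤ P.K ∧ ((datumOfRecord₁₂ F N θ' h').C P).flow.InInterval γ P.K :=
  ⟨θ, hP, hU, hθ, N24_endStatementBPrinted₁₂_pointed_all θ hP hθ w hC hγ hL hup h05 h06 h07 h08 h09 h11dom hres huniq h10 h11 h12 hR hUV hlo hhi,
    N24_window_of_betaUpperH _ hγ.1 hhi⟩

end Literature.MathematicalPhysics.QuantumFieldTheory.Balaban1983to89.Node00

end
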